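import Summits.NavierStokesRegularity.NavierStokesRegularity.Theorems.ExtremiserTransienceDepletedFractionCleanLockedWindow
import Summits.NavierStokesRegularity.NavierStokesRegularity.Theorems.ExtremiserTransienceDepletedFractionDefs
import Summits.NavierStokesRegularity.NavierStokesRegularity.Theses.ExtremiserTransience
import HarnessLib

/-!
# Crux `NearExtremalTransiencePerFlow` (stmt-NavierStokesRegularity-26567), LINE g13-α «budget-cut» (ns-idea-5 g13)

NO SUMMIT IS PROVED BY A LINE.  This is a checked skeleton for the rank-2 crux of route `ExtremiserTransience`
(`closes hT hC hII hA : NavierStokesRegularity` consumes the crux as `hT`); it bears on LADDER-NS rung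
«ExtremiserTransience / NearExtremalTransiencePerFlow ⟨26567⟩» and on nothing above it.  The heart C♭ below, the flank K♭,
the crux and NS regularity remain OPEN.

## What the technique card («extremal-example mining») produced this generation

(1) **An extremal example against the heart of record.**  The line of record g12-β «depleted-fraction» reduces the crux, by kernel,
to ONE registered stub X♭ `DepletedFraction` (texts of record `…Theorems…DepletedFraction.DepletedFraction`, p720463): «for all
`Θ G H τ₁ > 0` there is `ε > 0` such that in EVERY classical Leray–Hopf flow, EVERY admissible window `[t, t + τ₁ν/M²]` (height bound
`M` at `t`, Taylor lock `Z(t) ≤ Θ(ν/M)²P(t)`, gradient `≤ GM²/ν` at `t`, heights `≤ HM` on the window) has `ε`-depleted times of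
measure `≥ ε·τ₁ν/M²`».  Mining the route's founding examples for the CHEAPEST admissible window gives a counterexample scheme
(card §X♭-autopsy; sketch, not a Lean refutation): take a smooth rapidly decaying divergence-free BULK `B` with depletion quotient
`q(B) > κ⋆ − ε/4` (exists because `κ⋆ = sInf udcSet`), add a divergence-free RIPPLE `R_ℓ` (wave packet of wavelength `ℓ`, enstrophy
`θ·Z(B)`, amplitude `≍ ℓ√θ`), and declare the window with an OVERSIZED height bound `M ≫ ‖B‖_∞`: the ripple's palinstrophy
`θZ(B)/ℓ²` buys the Taylor lock for any `M` once `ℓ ≤ ν√(Θθ)/M`, the gradient and height bounds hold trivially, the ripple dies after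
`t_* ≍ (ℓ²/ν) log M` — a fraction `≍ Θθ log M/τ₁` of the window — and for the rest of the window (which is `τ₁ν/M²`, arbitrarily short on
the bulk's own clock) the flow is the near-extremal bulk, NOT `ε`-depleted.  With `θ := (log M)^{-2}` and `M → ∞` the depleted fraction is
`≲ Θ/(τ₁ log M) → 0`, smaller than any `ε`: **X♭ is false as typed** (modulo the classical local theory needed to run the flow).  The two typing
defects it exposes: (a) the window height `M` is only an UPPER bound, decoupled from the true height, so `τ₁ν/M²` need not be a
turnover time of the flow; (b) the lock `Z ≤ Θ(ν/M)²P` is purchasable by a negligible high-frequency component, so it does not pin the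
cell scale.  The USE of X♭ in the β skeleton is untouched by the example: β only ever instantiates X♭ at the windows of the landed W♭,
whose height bound is the Type-I envelope `M = C√ν/√(T−τ)` of a violator — comparable to the true height by Leray's lower rate
(`Literature…leray_blowup_rate_top_holds`) — and inside ONE flow.  Hence the repair below.

(2) **The repaired and cut heart.**  All statements of this line are PER VIOLATOR (`IsViolator C ν T u p →`, so `ε` may depend on
the flow: a sequence-of-flows example like (1) is no longer an instance) and carry the SCALE PIN `M = C√ν/√(T−t)` (so the budget
unit `M·ν` is the violator's natural cell enstrophy `≍ ν^{3/2}(T−t)^{-1/2}` and defect (a) is gone; defect (b) becomes harmless because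
no statement below uses the lock to localise anything).  The pin is exported by W♭⁺ `CleanLockedWindowAtScale` = the landed W♭ with
the one extra conjunct `M = C√ν/√(T−τ)`, PROVED IN THIS FILE by the landed proof of p719836 verbatim (the proof defines `M` so).
The mined dichotomy parameter is the enstrophy BUDGET at the window's start in cell units:
  * near-extremality forces the enstrophy to sit in cells of near-MAXIMAL amplitude (height penalty: `J ≤ κ⋆ Σᵢ aᵢ√(ZᵢPᵢ)` cell by
    cell, so `q ≥ κ⋆ − δ` forces the `Z`-weighted mean amplitude `≥ (1 − 2δ/κ⋆)·h`), a cell of amplitude `≍ h ≍ M` under the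
    gradient bound `GM²/ν` has size `≥ ν/(GM)` and enstrophy `≳ Mν/G`, so a budget `Z ≤ N₀·Mν` allows at most `≍ N₀G` such cells:
    BOUNDED BUDGET = FINITELY MANY TALL CELLS = tight up to finitely many separating clusters = the compactness class;
  * UNBOUNDED BUDGET = arbitrarily many tall natural-size cells = the crowd («unbounded cell multiplication», g4 KEY RISK).

* **K♭ `SmallBudgetDepletion` (FLANK, per violator, pinned; believed PROVABLE from the tree, XL in Lean).**  In a violator, every
  pinned admissible window whose start slice has `Z(t) ≤ N₀·(Mν)` has `ε`-depleted times of measure `≥ ε|I|`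
  (`∀ violator ∀ Θ G H τ₁ N₀ ∃ ε ∀ windows`).  Plan (card §K♭): negation ⇒ windows `(tₙ, Mₙ)` of ONE violator with depleted fraction
  `< 1/n`, hence a non-depleted time `tₙ'` in the right half of each window with TRUE quotient `q(tₙ') > κ⋆ − 1/n`; (B) `tₙ' → t* < T`:
  `t* ≥ τ₁T/(2C²) > 0`, continuity of `q` at a regular time and the landed strict inequality `slice_lt_sharp` — absurd; (A) `tₙ' → T`:
  `T − tₙ' ≍ T − tₙ`, budget at `tₙ'` `≤ N₀e^{κ⋆²H²τ₁/2}Mₙν` (enstrophy balance over the window), height `≍ Mₙ` (Leray lower rate /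
  Type-I), gradient at the Type-I rate; zoom at `tₙ'` (landed `MemberSelection.ZoomPackage`/`ZoomCompact`): near-extremal slices with
  bounded budget and gradient in natural units ⇒ (finitely-many-tall-cells lemma, the static core = g11-α's T `TightOfBoundedBudget`
  with the height penalty made explicit) a best cluster, tight, with cluster quotient `→ κ⋆` ⇒ its translate-limit is an
  `IsExtremalSlice` of the Type-I ancient mild zoom limit at a negative time ⇒ excluded by the landed
  `MemberSelection.not_isExtremalSlice_of_typeIAncientMild`.
* **C♭ `CrowdDepletion` (HEART, per violator, pinned, OPEN).**  Same frame with `N₀·(Mν) ≤ Z(t)` and `N₀` at the prover's disposal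
  (`∀ violator ∀ Θ G H τ₁ ∃ N₀ ε ∀ windows`): crowded late windows of a violator deplete.  The honest residual.  Per-violator typing
  lets its prover use the energy class (`∫Z ≤ E₀/2ν`), the Type-I zoom, linear growth (F1) and the landed ledger theorems
  `LocalChainLiouville` / `LocalCrowdingLiouville` / `UniformDissipationBudget`-type tools — none of which X♭'s all-flows typing admitted.
* **Skeleton** (kernel-checked; ONE theorem concluding the crux BY NAME; sorries = the two stubs): W♭⁺ (proved here) → violator's
  constants and pinned clean window; K♭ ∧ C♭ ⇒ pinned X♭-per-violator (`pinnedDepletedFraction_of`: C♭ names `N₀`, K♭ at that `N₀`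
  names `ε_K`, `ε = min ε_K ε_C`, case split on `Z(t) ≤ N₀Mν`, monotonicity of the depleted set in `ε`) ⇒ the crux by the g12-β measure
  sandwich `ε|I| ≤ |DEPLETED ∩ I| ≤ |{k ≤ m} ∩ I| ≤ (ε/2)|I|`.  Sanity (proved): X♭ of record ⇒ K♭ ∧ C♭ (the line asks for less than
  the — refutable — line of record; both stubs avoid the example of (1) by the pin and the per-violator quantifier).

Levers of the listed lines in five words: «extremal tangent slice + Liouville» (tangent/regularised_transfer), «analytic DSS gap»
(analytic_gap, sparse_bangbang, bangbang_core), «zone sojourn + descent bounds» (zone_transversality), «filament / chain / crowding + ledger»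
(filament_*, dissipation_ledger, tight_or_chain, multiscale_crowding), «tight + quarter law» (leray_pincer), «symmetry germ» (symmetry_harvest),
«local maximiser + thick good centre» (ns-idea-10 local_maximiser / two_thirds), «pointwise exit + gap covering» (transience_exit), «density
below one per turnover» (depleted_fraction).  Lever here: «pinned budget in cell units».  HONEST GRADE: a REPAIR-AND-CUT of the line of
record's heart, not a new mechanism; nearest relatives leray_pincer (same budget parameter; there the bounded side is a static family lemma and
the unbounded side is EXCLUDED by a Leray-rate hypothesis Q♭ of the quarter-law family — here the unbounded side is asked to DEPLETE, a
transience statement, and nothing of the quarter-law family is assumed) and depleted_fraction (parent; its X♭ is shown refutable as typed).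

INSTRUMENT ROW (design only — the lineage kit is closed, KEY-NS #213/#217/#221/#222): RIPPLE-LOCK (new, refutes X♭ numerically): NS from
`B + R_ℓ` with `B` the g11 record crystal, `ℓ = 2^{-k}`, `θ = 4^{-k}`, window `M = 2^k‖B‖_∞`: predicted depleted fraction `→ 0` like
`Θθ k/τ₁`; BUDGET-LADDER (g11 design row) for C♭: depleted fraction of pinned windows started from crystals truncated to `N` cells.

HONEST FRAMING: K♭ is a compactness statement believed provable from the tree (its static core is not yet landed); C♭ is a conjecture
about short-time Navier–Stokes dynamics of crowded near-extremal configurations inside a Type-I violator; the counterexample to X♭ is a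
sketch with explicit parameters, not a Lean refutation; nothing about Navier–Stokes regularity or blow-up is proved here. [folklore]
-/


noncomputable section

open scoped Topology InnerProductSpace RealInnerProductSpace ENNReal ContDiff
open MeasureTheory Filter Set Metric
open Literature.Analysis.FluidPDE
open Summit.NavierStokesRegularity.NavierStokesRegularity.Theses.ExtremiserTransience
open Summit.NavierStokesRegularity.NavierStokesRegularity.Theorems
open Summit.NavierStokesRegularity.NavierStokesRegularity.Theorems.DepletionLadder.KStar.HalfSpace
open Summit.NavierStokesRegularity.NavierStokesRegularity.Theorems.NearExtremalTransiencePerFlow.ZoneTransversality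
open Summit.NavierStokesRegularity.NavierStokesRegularity.Theorems.NearExtremalTransiencePerFlow.DepletedFraction

namespace Summit.NavierStokesRegularity.NavierStokesRegularity.Cruxes.NearExtremalTransiencePerFlow.BudgetCut

-- the summit's namespace repeats the problem name by convention (D-0017)
set_option linter.dupNamespace false
set_option linter.style.longLine false

/-! ## §0 The depleted set of a flow (abbreviation used only in this file's proofs; the statements spell it out) -/

/-- The `ε`-DEPLETED times of `u`: the flow-wise clause holds with coefficient `κ⋆ − ε` at every height bound. -/
def depletedSet (u : ℝ → EuclideanSpace ℝ (Fin 3) → EuclideanSpace ℝ (Fin 3)) (ε : ℝ) : Set ℝ :=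
  {t' : ℝ | ∀ M' : ℝ, (∀ x, ‖u t' x‖ ≤ M') →
    |∫ x, ⟪curl (u t') x, fderiv ℝ (u t') x (curl (u t') x)⟫_ℝ| ≤
      (kStar - ε) * M' * Real.sqrt (∫ x, ‖curl (u t') x‖ ^ 2) *
        Real.sqrt (∫ x, frobeniusNormSq (fderiv ℝ (curl (u t')) x))}

/-- The depleted set GROWS as `ε` decreases. -/
theorem depletedSet_mono (u : ℝ → EuclideanSpace ℝ (Fin 3) → EuclideanSpace ℝ (Fin 3)) {ε ε' : ℝ} (h : ε ≤ ε') :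
    depletedSet u ε' ⊆ depletedSet u ε := by
  intro t' ht' M' hM'
  have hM'0 : 0 ≤ M' := (norm_nonneg _).trans (hM' 0)
  have hP : 0 ≤ M' * Real.sqrt (∫ x, ‖curl (u t') x‖ ^ 2) *
      Real.sqrt (∫ x, frobeniusNormSq (fderiv ℝ (curl (u t')) x)) := by positivity
  have hκ : kStar - ε' ≤ kStar - ε := by linarith
  calc |∫ x, ⟪curl (u t') x, fderiv ℝ (u t') x (curl (u t') x)⟫_ℝ|
      ≤ (kStar - ε') * M' * Real.sqrt (∫ x, ‖curl (u t') x‖ ^ 2) *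
          Real.sqrt (∫ x, frobeniusNormSq (fderiv ℝ (curl (u t')) x)) := ht' M' hM'
    _ = (kStar - ε') * (M' * Real.sqrt (∫ x, ‖curl (u t') x‖ ^ 2) *
          Real.sqrt (∫ x, frobeniusNormSq (fderiv ℝ (curl (u t')) x))) := by ring
    _ ≤ (kStar - ε) * (M' * Real.sqrt (∫ x, ‖curl (u t') x‖ ^ 2) *
          Real.sqrt (∫ x, frobeniusNormSq (fderiv ℝ (curl (u t')) x))) := mul_le_mul_of_nonneg_right hκ hP
    _ = (kStar - ε) * M' * Real.sqrt (∫ x, ‖curl (u t') x‖ ^ 2) *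
          Real.sqrt (∫ x, frobeniusNormSq (fderiv ℝ (curl (u t')) x)) := by ring

/-- Monotonicity of the depleted FRACTION claim in `ε`: a lower bound at `ε'` gives the lower bound at every `ε ≤ ε'`. -/
theorem fraction_mono (u : ℝ → EuclideanSpace ℝ (Fin 3) → EuclideanSpace ℝ (Fin 3)) {ε ε' L : ℝ} (I : Set ℝ)
    (h : ε ≤ ε') (hL : 0 ≤ L)
    (hfrac : ENNReal.ofReal (ε' * L) ≤ volume (depletedSet u ε' ∩ I)) :
    ENNReal.ofReal (ε * L) ≤ volume (depletedSet u ε ∩ I) := by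
  have h1 : ENNReal.ofReal (ε * L) ≤ ENNReal.ofReal (ε' * L) :=
    ENNReal.ofReal_le_ofReal (mul_le_mul_of_nonneg_right h hL)
  have h2 : volume (depletedSet u ε' ∩ I) ≤ volume (depletedSet u ε ∩ I) :=
    measure_mono (Set.inter_subset_inter_left _ (depletedSet_mono u h))
  exact h1.trans (hfrac.trans h2)

/-! ## §1 The statements of the line -/

/-- **W♭⁺ — CLEAN LOCKED WINDOW AT THE TYPE-I SCALE (flow side; PROVED below, §3).**  The landed W♭ `CleanLockedWindow`
(`…DepletedFraction.cleanLockedWindow_holds`, p719836) with ONE extra conjunct exporting the SCALE PIN `M = C√ν/√(T−τ)` of its window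
(the landed proof defines `M` so; the pin makes `M` comparable to the true height by Leray's lower rate, and `M·ν` the natural cell
enstrophy).  A violator carries a coefficient `k` with the strict-efficiency read-back, constants `Θ, G, H, c_w > 0`, and for every level
`κ⋆/2 ≤ m < κ⋆`, every `η > 0`, every `0 < τ₁ ≤ c_w` ONE pinned packaged instant `τ` whose forward window is `η`-clean. -/
def CleanLockedWindowAtScale : Prop :=
  ∀ (C ν T : ℝ) (u : ℝ → EuclideanSpace ℝ (Fin 3) → EuclideanSpace ℝ (Fin 3)) (p : ℝ → EuclideanSpace ℝ (Fin 3) → ℝ),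
    IsViolator C ν T u p →
    ∃ (k : ℝ → ℝ) (Θ G H c_w : ℝ),
      (∀ t ∈ Set.Ico 0 T, ∀ m : ℝ, 0 ≤ m → m < k t → ∃ M : ℝ, (∀ x, ‖u t x‖ ≤ M) ∧
        m * M * Real.sqrt (∫ x, ‖curl (u t) x‖ ^ 2) * Real.sqrt (∫ x, frobeniusNormSq (fderiv ℝ (curl (u t)) x)) <
          |∫ x, ⟪curl (u t) x, fderiv ℝ (u t) x (curl (u t) x)⟫_ℝ|) ∧
      0 < Θ ∧ 0 < G ∧ 0 < H ∧ 0 < c_w ∧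
      ∀ m : ℝ, kStar / 2 ≤ m → m < kStar → ∀ η : ℝ, 0 < η → ∀ τ₁ : ℝ, 0 < τ₁ → τ₁ ≤ c_w →
        ∃ τ M : ℝ, 0 ≤ τ ∧ 0 < M ∧ τ + τ₁ * ν / M ^ 2 < T ∧ M = C * Real.sqrt ν / Real.sqrt (T - τ) ∧ (∀ x, ‖u τ x‖ ≤ M) ∧
          (∫ x, ‖curl (u τ) x‖ ^ 2) ≤ Θ * (ν / M) ^ 2 * (∫ x, frobeniusNormSq (fderiv ℝ (curl (u τ)) x)) ∧
          (∀ x, ‖fderiv ℝ (u τ) x‖ ≤ G * M ^ 2 / ν) ∧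
          (∀ t' ∈ Set.Icc τ (τ + τ₁ * ν / M ^ 2), ∀ x, ‖u t' x‖ ≤ H * M) ∧
          volume ({σ : ℝ | k σ ≤ m} ∩ Set.Icc τ (τ + τ₁ * ν / M ^ 2)) ≤ ENNReal.ofReal (η * (τ₁ * ν / M ^ 2))

/-- **K♭ — SMALL-BUDGET DEPLETION (FLANK, per violator, pinned; believed PROVABLE, XL).**  In a violator flow (`IsViolator C ν T u p`),
every PINNED admissible window — height bound `M = C√ν/√(T−t)` at `t` (the Type-I envelope), Taylor lock `Z(t) ≤ Θ(ν/M)²P(t)`, gradient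
`≤ GM²/ν` at `t`, heights `≤ HM` on `I = [t, t + τ₁ν/M²] ⊂ [0,T)` — whose start slice has enstrophy budget AT MOST `N₀` cell units,
`Z(t) ≤ N₀·(Mν)`, has `ε`-depleted times of measure `≥ ε|I|`.  `∀ violator ∀ Θ G H τ₁ N₀ > 0 ∃ ε > 0 ∀ pinned windows`. -/
def SmallBudgetDepletion : Prop :=
  ∀ (C ν T : ℝ) (u : ℝ → EuclideanSpace ℝ (Fin 3) → EuclideanSpace ℝ (Fin 3)) (p : ℝ → EuclideanSpace ℝ (Fin 3) → ℝ),
    IsViolator C ν T u p →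
    ∀ (Θ G H τ₁ N₀ : ℝ), 0 < Θ → 0 < G → 0 < H → 0 < τ₁ → 0 < N₀ → ∃ ε : ℝ, 0 < ε ∧
    ∀ (t M : ℝ), 0 ≤ t → 0 < M → t + τ₁ * ν / M ^ 2 < T → M = C * Real.sqrt ν / Real.sqrt (T - t) →
      (∀ x, ‖u t x‖ ≤ M) →
      (∫ x, ‖curl (u t) x‖ ^ 2) ≤ Θ * (ν / M) ^ 2 * (∫ x, frobeniusNormSq (fderiv ℝ (curl (u t)) x)) →
      (∀ x, ‖fderiv ℝ (u t) x‖ ≤ G * M ^ 2 / ν) →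
      (∀ t' ∈ Set.Icc t (t + τ₁ * ν / M ^ 2), ∀ x, ‖u t' x‖ ≤ H * M) →
      (∫ x, ‖curl (u t) x‖ ^ 2) ≤ N₀ * (M * ν) →
      ENNReal.ofReal (ε * (τ₁ * ν / M ^ 2)) ≤
        volume ({t' : ℝ | ∀ M' : ℝ, (∀ x, ‖u t' x‖ ≤ M') →
            |∫ x, ⟪curl (u t') x, fderiv ℝ (u t') x (curl (u t') x)⟫_ℝ| ≤
              (kStar - ε) * M' * Real.sqrt (∫ x, ‖curl (u t') x‖ ^ 2) *
                Real.sqrt (∫ x, frobeniusNormSq (fderiv ℝ (curl (u t')) x))} ∩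
          Set.Icc t (t + τ₁ * ν / M ^ 2))

/-- **C♭ — CROWD DEPLETION (HEART, per violator, pinned, OPEN).**  In a violator flow, for every window package `(Θ, G, H, τ₁)` there are
a budget threshold `N₀` and a fraction `ε > 0` such that every PINNED admissible window (`M = C√ν/√(T−t)`) whose start slice carries AT
LEAST `N₀` cell units of enstrophy, `N₀·(Mν) ≤ Z(t)`, has `ε`-depleted times of measure `≥ ε|I|`.  `∀ violator ∀ Θ G H τ₁ > 0 ∃ N₀ ε > 0
∀ pinned windows`.  (X♭ restricted to CROWDED late windows of ONE violator: the residual enemy «unbounded cell multiplication».) -/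
def CrowdDepletion : Prop :=
  ∀ (C ν T : ℝ) (u : ℝ → EuclideanSpace ℝ (Fin 3) → EuclideanSpace ℝ (Fin 3)) (p : ℝ → EuclideanSpace ℝ (Fin 3) → ℝ),
    IsViolator C ν T u p →
    ∀ (Θ G H τ₁ : ℝ), 0 < Θ → 0 < G → 0 < H → 0 < τ₁ → ∃ N₀ ε : ℝ, 0 < N₀ ∧ 0 < ε ∧
    ∀ (t M : ℝ), 0 ≤ t → 0 < M → t + τ₁ * ν / M ^ 2 < T → M = C * Real.sqrt ν / Real.sqrt (T - t) →
      (∀ x, ‖u t x‖ ≤ M) →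
      (∫ x, ‖curl (u t) x‖ ^ 2) ≤ Θ * (ν / M) ^ 2 * (∫ x, frobeniusNormSq (fderiv ℝ (curl (u t)) x)) →
      (∀ x, ‖fderiv ℝ (u t) x‖ ≤ G * M ^ 2 / ν) →
      (∀ t' ∈ Set.Icc t (t + τ₁ * ν / M ^ 2), ∀ x, ‖u t' x‖ ≤ H * M) →
      N₀ * (M * ν) ≤ (∫ x, ‖curl (u t) x‖ ^ 2) →
      ENNReal.ofReal (ε * (τ₁ * ν / M ^ 2)) ≤
        volume ({t' : ℝ | ∀ M' : ℝ, (∀ x, ‖u t' x‖ ≤ M') →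
            |∫ x, ⟪curl (u t') x, fderiv ℝ (u t') x (curl (u t') x)⟫_ℝ| ≤
              (kStar - ε) * M' * Real.sqrt (∫ x, ‖curl (u t') x‖ ^ 2) *
                Real.sqrt (∫ x, frobeniusNormSq (fderiv ℝ (curl (u t')) x))} ∩
          Set.Icc t (t + τ₁ * ν / M ^ 2))

/-- **X♭ per violator at pinned windows** (the REPAIRED heart: `ε` may depend on the violator, `M` is the Type-I envelope; the two stubs
are a cut of THIS, and THIS is what the skeleton consumes). -/
def PinnedDepletedFraction : Prop :=
  ∀ (C ν T : ℝ) (u : ℝ → EuclideanSpace ℝ (Fin 3) → EuclideanSpace ℝ (Fin 3)) (p : ℝ → EuclideanSpace ℝ (Fin 3) → ℝ),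
    IsViolator C ν T u p →
    ∀ (Θ G H τ₁ : ℝ), 0 < Θ → 0 < G → 0 < H → 0 < τ₁ → ∃ ε : ℝ, 0 < ε ∧
    ∀ (t M : ℝ), 0 ≤ t → 0 < M → t + τ₁ * ν / M ^ 2 < T → M = C * Real.sqrt ν / Real.sqrt (T - t) →
      (∀ x, ‖u t x‖ ≤ M) →
      (∫ x, ‖curl (u t) x‖ ^ 2) ≤ Θ * (ν / M) ^ 2 * (∫ x, frobeniusNormSq (fderiv ℝ (curl (u t)) x)) →
      (∀ x, ‖fderiv ℝ (u t) x‖ ≤ G * M ^ 2 / ν) →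
      (∀ t' ∈ Set.Icc t (t + τ₁ * ν / M ^ 2), ∀ x, ‖u t' x‖ ≤ H * M) →
      ENNReal.ofReal (ε * (τ₁ * ν / M ^ 2)) ≤
        volume ({t' : ℝ | ∀ M' : ℝ, (∀ x, ‖u t' x‖ ≤ M') →
            |∫ x, ⟪curl (u t') x, fderiv ℝ (u t') x (curl (u t') x)⟫_ℝ| ≤
              (kStar - ε) * M' * Real.sqrt (∫ x, ‖curl (u t') x‖ ^ 2) *
                Real.sqrt (∫ x, frobeniusNormSq (fderiv ℝ (curl (u t')) x))} ∩
          Set.Icc t (t + τ₁ * ν / M ^ 2))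

/-! ## §2 Registered stubs (the ONLY sorries of the file) -/

/-- FLANK (XL; believed provable: right-half non-depleted time; `slice_lt_sharp` at regular times; zoom + finitely-many-tall-cells +
`not_isExtremalSlice_of_typeIAncientMild` at times `→ T`). -/
theorem stub_smallBudgetDepletion : SmallBudgetDepletion := by
  sorry

/-- HEART (open): crowded pinned late windows of a violator deplete. -/
theorem stub_crowdDepletion : CrowdDepletion := by
  sorry

namespace Registered

/-- registered name of the flank K♭. -/
abbrev stub_smallBudgetDepletion : Prop := SmallBudgetDepletion
/-- registered name of the heart C♭. -/
abbrev stub_crowdDepletion : Prop := CrowdDepletion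

end Registered

/-! ## §3 The cut: K♭ ∧ C♭ ⇒ X♭ per violator (pure logic + monotonicity in `ε`) -/

/-- **The budget cut.**  `SmallBudgetDepletion ∧ CrowdDepletion → PinnedDepletedFraction`: C♭ names `N₀`; K♭ at that `N₀` names `ε_K`;
take `ε = min ε_K ε_C` and split each window on `Z(t) ≤ N₀·Mν`. -/
theorem pinnedDepletedFraction_of (hK : SmallBudgetDepletion) (hC : CrowdDepletion) : PinnedDepletedFraction := by
  intro C ν T u p hV Θ G H τ₁ hΘ hG hH hτ₁
  have hν : 0 < ν := hV.2.1
  obtain ⟨N₀, εC, hN₀, hεC, hC1⟩ := hC C ν T u p hV Θ G H τ₁ hΘ hG hH hτ₁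
  obtain ⟨εK, hεK, hK1⟩ := hK C ν T u p hV Θ G H τ₁ N₀ hΘ hG hH hτ₁ hN₀
  refine ⟨min εK εC, lt_min hεK hεC, ?_⟩
  intro t M ht hM htT hpin hMb hlock hgrad hheights
  have hL : 0 ≤ τ₁ * ν / M ^ 2 := by positivity
  rcases le_or_gt (∫ x, ‖curl (u t) x‖ ^ 2) (N₀ * (M * ν)) with hsmall | hbig
  · have h := hK1 t M ht hM htT hpin hMb hlock hgrad hheights hsmall
    exact fraction_mono u (Set.Icc t (t + τ₁ * ν / M ^ 2)) (min_le_left _ _) hL h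
  · have h := hC1 t M ht hM htT hpin hMb hlock hgrad hheights hbig.le
    exact fraction_mono u (Set.Icc t (t + τ₁ * ν / M ^ 2)) (min_le_right _ _) hL h

/-! ## §4 Sanity: the line asks for LESS than the line of record (texts of record `…Theorems…DepletedFraction`, p720463) -/

/-- X♭ ⇒ X♭ per violator. -/
theorem pinnedDepletedFraction_of_depletedFraction
    (hX : Summit.NavierStokesRegularity.NavierStokesRegularity.Theorems.NearExtremalTransiencePerFlow.DepletedFraction.DepletedFraction) :
    PinnedDepletedFraction := by
  intro C ν T u p hV Θ G H τ₁ hΘ hG hH hτ₁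
  obtain ⟨ε, hε, h1⟩ := hX Θ G H τ₁ hΘ hG hH hτ₁
  exact ⟨ε, hε, fun t M ht hM htT _hpin hMb hlock hgrad hheights =>
    h1 ν T hV.2.1 hV.2.2.1 u p hV.2.2.2.1 hV.2.2.2.2.1 hV.2.2.2.2.2.1 t M ht hM htT hMb hlock hgrad hheights⟩

/-- X♭ ⇒ K♭ (drop the budget hypothesis). -/
theorem smallBudgetDepletion_of_depletedFraction
    (hX : Summit.NavierStokesRegularity.NavierStokesRegularity.Theorems.NearExtremalTransiencePerFlow.DepletedFraction.DepletedFraction) :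
    SmallBudgetDepletion := by
  intro C ν T u p hV Θ G H τ₁ N₀ hΘ hG hH hτ₁ _hN₀
  obtain ⟨ε, hε, h1⟩ := pinnedDepletedFraction_of_depletedFraction hX C ν T u p hV Θ G H τ₁ hΘ hG hH hτ₁
  exact ⟨ε, hε, fun t M ht hM htT hpin hMb hlock hgrad hheights _ => h1 t M ht hM htT hpin hMb hlock hgrad hheights⟩

/-- X♭ ⇒ C♭ (drop the budget hypothesis; any `N₀`). -/
theorem crowdDepletion_of_depletedFraction
    (hX : Summit.NavierStokesRegularity.NavierStokesRegularity.Theorems.NearExtremalTransiencePerFlow.DepletedFraction.DepletedFraction) :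
    CrowdDepletion := by
  intro C ν T u p hV Θ G H τ₁ hΘ hG hH hτ₁
  obtain ⟨ε, hε, h1⟩ := pinnedDepletedFraction_of_depletedFraction hX C ν T u p hV Θ G H τ₁ hΘ hG hH hτ₁
  exact ⟨1, ε, one_pos, hε, fun t M ht hM htT hpin hMb hlock hgrad hheights _ => h1 t M ht hM htT hpin hMb hlock hgrad hheights⟩

/-! ## §5 W♭⁺ proved: the landed proof of W♭ (p719836, `…DepletedFraction.cleanLockedWindow_holds`) VERBATIM, exporting the pin -/

/-- **W♭⁺ holds.**  Proof = the landed proof of `cleanLockedWindow_holds` (ns-net-p1 g15, p719836) with the single extra conjunct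
`M = C√ν/√(T−τ)` discharged by `rfl` (the proof defines `M` so).  [folklore] -/
theorem cleanLockedWindowAtScale_holds : CleanLockedWindowAtScale := by
  intro C ν T u p hV
  obtain ⟨hC, hν, hT, hsol, hLH, hdec, hrate, hsing, hno⟩ := hV
  have hsν : 0 < Real.sqrt ν := Real.sqrt_pos.2 hν
  have hC2 : 0 < C ^ 2 := by positivity
  -- the canonical coefficient: read-back and full upper log-density of efficient times
  obtain ⟨k, hkm, hk01, hcl, hkle, hread, hdens⟩ :=
    DepletionLadder.PerFlow.efficientTimes_logDensity_of_not_perFlow hν hT hsol hLH hdec hno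
  -- locked late times have lower log-density `d₀`
  obtain ⟨c₂, d₀, hd₀, hS⟩ := DepletionLadder.PerFlow.lockedTimes_logDensity hC hν hT hsol hLH hdec hrate hsing
  -- the Type-I onset and the gradient-rate onset
  obtain ⟨a₀, ha₀T, hsubI⟩ := mem_nhdsLT_iff_exists_Ioo_subset.1 hrate
  have ha₀T' : a₀ < T := ha₀T
  obtain ⟨C₁, hC₁, hgradev⟩ := DepletionLadder.PerFlow.gradTypeIRate_of_typeIRate hC hν hT hsol hLH hdec hrate
  obtain ⟨a₁, ha₁T, hsubG⟩ := mem_nhdsLT_iff_exists_Ioo_subset.1 hgradev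
  have ha₁T' : a₁ < T := ha₁T
  -- the onset `t₀ ∈ [0,T)`, strictly past both onsets
  set t₀ : ℝ := max 0 ((max a₀ a₁ + T) / 2) with ht₀def
  have hmaxT : max a₀ a₁ < T := max_lt ha₀T' ha₁T'
  have ht₀T : t₀ < T := max_lt hT (by linarith)
  have ht₀0 : 0 ≤ t₀ := le_max_left _ _
  have ha₀t₀ : a₀ < t₀ := lt_of_lt_of_le (by linarith [le_max_left a₀ a₁]) (le_max_right _ _)
  have ha₁t₀ : a₁ < t₀ := lt_of_lt_of_le (by linarith [le_max_right a₀ a₁]) (le_max_right _ _)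
  -- Type-I and gradient bounds past `t₀`
  have hTypeI : ∀ s : ℝ, t₀ ≤ s → s < T → ∀ x, ‖u s x‖ ≤ C * Real.sqrt ν / Real.sqrt (T - s) := by
    intro s h1 h2 x
    have hsq : 0 < Real.sqrt (T - s) := Real.sqrt_pos.2 (sub_pos.2 h2)
    rw [le_div_iff₀ hsq, mul_comm]
    exact hsubI ⟨ha₀t₀.trans_le h1, h2⟩ x
  have hGrad : ∀ s : ℝ, t₀ ≤ s → s < T → ∀ x, ‖fderiv ℝ (u s) x‖ ≤ C₁ / (T - s) := by
    intro s h1 h2 x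
    have hTs : 0 < T - s := sub_pos.2 h2
    rw [le_div_iff₀ hTs, mul_comm]
    exact hsubG ⟨ha₁t₀.trans_le h1, h2⟩ x
  -- the constants
  refine ⟨k, max c₂ 1 * C ^ 2, C₁ / C ^ 2, 2, C ^ 2 / 2, hread, by positivity, by positivity, by norm_num,
    by positivity, ?_⟩
  intro m hm_lo hm_lt η hη τ₁ hτ₁ hτ₁cw
  have hK : 0 < kStar := kStar_pos
  have hm0 : 0 ≤ m := by linarith
  -- the relative window length `a = τ₁/C² ∈ (0, 1/2]`
  set a : ℝ := τ₁ / C ^ 2 with hadef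
  have ha : 0 < a := div_pos hτ₁ hC2
  have ha2 : a ≤ 1 / 2 := by
    rw [hadef, div_le_iff₀ hC2]
    linarith
  have ha1 : a < 1 := by linarith
  -- the efficient / inefficient sets
  have hEm : MeasurableSet {s : ℝ | m < k s} := measurableSet_lt measurable_const hkm
  have hFm : MeasurableSet {σ : ℝ | k σ ≤ m} := measurableSet_le hkm measurable_const
  -- the locked set past `t₀`
  obtain ⟨S, hSmeas, hSsub, c, hSdens⟩ := hS t₀ ⟨ht₀0, ht₀T⟩
  -- the full-density instant `t`, with `δ = 1 − ηd₀/4`, `B = 1 + ηc/2`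
  have hmK : m < kStar := hm_lt
  unfold kStar udcSet at hmK
  have hδ : 1 - η * d₀ / 4 < 1 := by
    have : 0 < η * d₀ / 4 := by positivity
    linarith
  obtain ⟨t, ht, hEt⟩ := hdens m hmK (1 - η * d₀ / 4) hδ (1 + η * c / 2) t₀ ⟨ht₀0, ht₀T⟩
  have ht₀t : t₀ ≤ t := ht.1
  have htT : t < T := ht.2
  have hTt : 0 < T - t := sub_pos.2 htT
  have hlog0 : 0 ≤ Real.log ((T - t₀) / (T - t)) :=
    Real.log_nonneg ((one_le_div hTt).2 (by linarith))
  have hSt := hSdens t ht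
  -- `Λ(F) = ℓ − Λ(E)`
  have hFE : (fun τ => ({σ : ℝ | k σ ≤ m} : Set ℝ).indicator (fun _ => (1 : ℝ)) τ / (T - τ)) =
      fun τ => 1 / (T - τ) - ({s : ℝ | m < k s} : Set ℝ).indicator (fun _ => (1 : ℝ)) τ / (T - τ) := by
    funext τ
    by_cases h : m < k τ
    · have h1 : τ ∈ ({s : ℝ | m < k s} : Set ℝ) := h
      have h2 : τ ∉ ({σ : ℝ | k σ ≤ m} : Set ℝ) := fun h' => absurd h (not_lt.2 h')
      rw [indicator_of_mem h1, indicator_of_notMem h2]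
      ring
    · have h1 : τ ∉ ({s : ℝ | m < k s} : Set ℝ) := h
      have h2 : τ ∈ ({σ : ℝ | k σ ≤ m} : Set ℝ) := not_lt.1 h
      rw [indicator_of_notMem h1, indicator_of_mem h2]
      ring
  have hΛF : ∫ τ in t₀..t, ({σ : ℝ | k σ ≤ m} : Set ℝ).indicator (fun _ => (1 : ℝ)) τ / (T - τ) =
      Real.log ((T - t₀) / (T - t)) - ∫ τ in t₀..t, ({s : ℝ | m < k s} : Set ℝ).indicator (fun _ => (1 : ℝ)) τ / (T - τ) := by
    have hIone : IntervalIntegrable (fun τ => (1 : ℝ) / (T - τ)) volume t₀ t := by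
      refine intervalIntegral.intervalIntegrable_one_div (fun τ hτ => ?_) (continuousOn_const.sub continuousOn_id)
      rw [Set.uIcc_of_le ht₀t] at hτ
      exact (sub_pos.2 (lt_of_le_of_lt hτ.2 htT)).ne'
    rw [hFE, intervalIntegral.integral_sub hIone (DepletionLadder.PerFlow.intervalIntegrable_indicator_div hEm ht₀t htT),
      integral_one_div_sub_eq_log ht₀t htT]
  -- the Tonelli count gives a clean locked point in `S`
  have hbig : 2 * (∫ τ in t₀..t, ({σ : ℝ | k σ ≤ m} : Set ℝ).indicator (fun _ => (1 : ℝ)) τ / (T - τ)) + 2 <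
      η * (∫ τ in t₀..t, S.indicator (fun _ => (1 : ℝ)) τ / (T - τ)) := by
    rw [hΛF]
    have h1 : η * (d₀ * Real.log ((T - t₀) / (T - t)) - c) ≤
        η * ∫ τ in t₀..t, S.indicator (fun _ => (1 : ℝ)) τ / (T - τ) := mul_le_mul_of_nonneg_left hSt hη.le
    have h2 : 0 ≤ η * d₀ * Real.log ((T - t₀) / (T - t)) := by positivity
    nlinarith [h1, hEt, h2]
  obtain ⟨τ, hτS, hclean⟩ := exists_clean_point ht₀t htT hSmeas hFm ha ha2 hη hbig
  -- the package at `τ`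
  obtain ⟨hτI, hlockτ⟩ := hSsub hτS
  have hτ0 : 0 ≤ τ := ht₀0.trans hτI.1
  have ht₀τ : t₀ ≤ τ := hτI.1
  have hτT : τ < T := hτI.2
  have hTτ : 0 < T - τ := sub_pos.2 hτT
  have hsqT : 0 < Real.sqrt (T - τ) := Real.sqrt_pos.2 hTτ
  set M : ℝ := C * Real.sqrt ν / Real.sqrt (T - τ) with hMdef
  have hM : 0 < M := by positivity
  have hM2 : M ^ 2 = C ^ 2 * ν / (T - τ) := by
    rw [hMdef, div_pow, mul_pow, Real.sq_sqrt hν.le, Real.sq_sqrt hTτ.le]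
  have hwin : τ₁ * ν / M ^ 2 = a * (T - τ) := by
    rw [hM2, hadef]
    field_simp
  have hνM : (ν / M) ^ 2 = ν * (T - τ) / C ^ 2 := by
    rw [div_pow, hM2]
    field_simp
  refine ⟨τ, M, hτ0, hM, ?_, rfl, fun x => hTypeI τ ht₀τ hτT x, ?_, ?_, ?_, ?_⟩
  · -- the window ends before `T`
    rw [hwin]
    have ha' : a * (T - τ) ≤ 1 / 2 * (T - τ) := mul_le_mul_of_nonneg_right ha2 hTτ.le
    linarith only [ha', hTτ]
  · -- the Taylor lock `Z ≤ Θ (ν/M)² P`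
    have hP0 : 0 ≤ ∫ x, frobeniusNormSq (fderiv ℝ (curl (u τ)) x) := integral_nonneg fun x => frobeniusNormSq_nonneg _
    have hνT : 0 ≤ ν * (T - τ) := by positivity
    calc (∫ x, ‖curl (u τ) x‖ ^ 2) ≤ c₂ * (ν * (T - τ)) * (∫ x, frobeniusNormSq (fderiv ℝ (curl (u τ)) x)) := hlockτ
      _ ≤ max c₂ 1 * (ν * (T - τ)) * (∫ x, frobeniusNormSq (fderiv ℝ (curl (u τ)) x)) :=
          mul_le_mul_of_nonneg_right (mul_le_mul_of_nonneg_right (le_max_left _ _) hνT) hP0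
      _ = max c₂ 1 * C ^ 2 * (ν / M) ^ 2 * (∫ x, frobeniusNormSq (fderiv ℝ (curl (u τ)) x)) := by
          rw [hνM]
          field_simp
  · -- the gradient bound `‖∇u(τ)‖ ≤ G M²/ν`
    intro x
    have h := hGrad τ ht₀τ hτT x
    have e : C₁ / C ^ 2 * M ^ 2 / ν = C₁ / (T - τ) := by
      rw [hM2]
      field_simp
    rw [e]
    exact h
  · -- heights `≤ 2M` on the window
    intro t' ht' x
    rw [hwin] at ht'
    have ha' : a * (T - τ) ≤ 1 / 2 * (T - τ) := mul_le_mul_of_nonneg_right ha2 hTτ.le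
    have ht'2 : t' ≤ τ + a * (T - τ) := ht'.2
    have ht'T : t' < T := by linarith only [ha', ht'2, hTτ]
    have hTt' : 0 < T - t' := sub_pos.2 ht'T
    have h4 : T - τ ≤ 4 * (T - t') := by linarith only [ha', ht'2, hTτ]
    have hb := hTypeI t' (ht₀τ.trans ht'.1) ht'T x
    have hsq : Real.sqrt (T - τ) ≤ 2 * Real.sqrt (T - t') := by
      have h2 : Real.sqrt 4 = 2 := by
        rw [show (4 : ℝ) = 2 ^ 2 by norm_num, Real.sqrt_sq (by norm_num)]
      calc Real.sqrt (T - τ) ≤ Real.sqrt (4 * (T - t')) := Real.sqrt_le_sqrt h4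
        _ = 2 * Real.sqrt (T - t') := by rw [Real.sqrt_mul (by norm_num), h2]
    have hsq' : 0 < Real.sqrt (T - t') := Real.sqrt_pos.2 hTt'
    have key : C * Real.sqrt ν / Real.sqrt (T - t') ≤ 2 * M := by
      rw [hMdef, div_le_iff₀ hsq',
        show 2 * (C * Real.sqrt ν / Real.sqrt (T - τ)) * Real.sqrt (T - t') =
          C * Real.sqrt ν * (2 * Real.sqrt (T - t')) / Real.sqrt (T - τ) by ring,
        le_div_iff₀ hsqT]
      exact mul_le_mul_of_nonneg_left hsq (mul_pos hC hsν).le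
    exact hb.trans key
  · -- cleanliness
    rw [hwin]
    exact hclean

/-! ## §6 THE SKELETON: K♭ + C♭ ⇒ the crux BY NAME (W♭⁺ is proved in §5; no `sorry` outside the two stubs) -/

/-- **pinned X♭ per violator ⇒ the crux** — the g12-β measure sandwich, run with W♭⁺ (`cleanLockedWindowAtScale_holds`, §5): violator
frame → W♭⁺'s constants `k, Θ, G, H, c_w` → `ε` (may depend on the violator) → level `m = κ⋆ − min(ε, κ⋆/2)`, cleanliness `ε/2` → W♭⁺'s
PINNED window at `τ` → `ε|I| ≤ |DEPLETED ∩ I| ≤ |{k ≤ m} ∩ I| ≤ (ε/2)|I|` with `|I| = c_w ν/M² > 0`: absurd. -/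
theorem nearExtremalTransiencePerFlow_of_pinned (hX : PinnedDepletedFraction) : NearExtremalTransiencePerFlow := by
  have hW := cleanLockedWindowAtScale_holds
  intro C ν T hC hν hT u p hsol hLH hdec hrate hsing
  by_contra hno
  have hV : IsViolator C ν T u p := ⟨hC, hν, hT, hsol, hLH, hdec, hrate, hsing, hno⟩
  obtain ⟨k, Θ, G, H, c_w, hkeff, hΘ, hGpos, hH, hcw, hwin⟩ := hW C ν T u p hV
  -- X♭'s fraction `ε` for THIS violator at window length `τ₁ = c_w`
  obtain ⟨ε, hε, hX1⟩ := hX C ν T u p hV Θ G H c_w hΘ hGpos hH hcw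
  have hK : 0 < kStar := kStar_pos
  obtain ⟨e, hedef⟩ : ∃ e : ℝ, e = min ε (kStar / 2) := ⟨_, rfl⟩
  have hepos : 0 < e := by rw [hedef]; exact lt_min hε (by linarith)
  have heε : e ≤ ε := by rw [hedef]; exact min_le_left _ _
  have heK : e ≤ kStar / 2 := by rw [hedef]; exact min_le_right _ _
  obtain ⟨m, hmdef⟩ : ∃ m : ℝ, m = kStar - e := ⟨_, rfl⟩
  have hm_lo : kStar / 2 ≤ m := by linarith
  have hm_lt : m < kStar := by linarith
  have hm0 : 0 ≤ m := by linarith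
  have hmε : kStar - ε ≤ m := by linarith
  have hη : 0 < ε / 2 := by linarith
  obtain ⟨τ, M, hτ0, hM0, hτT, hpin, hMb, hlock, hgrad, hheights, hclean⟩ :=
    hwin m hm_lo hm_lt (ε / 2) hη c_w hcw le_rfl
  have hfrac := hX1 τ M hτ0 hM0 hτT hpin hMb hlock hgrad hheights
  -- read-back: a depleted time of the window is an inefficient time (`k ≤ m`)
  have hsub : ({t' : ℝ | ∀ M' : ℝ, (∀ x, ‖u t' x‖ ≤ M') →
        |∫ x, ⟪curl (u t') x, fderiv ℝ (u t') x (curl (u t') x)⟫_ℝ| ≤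
          (kStar - ε) * M' * Real.sqrt (∫ x, ‖curl (u t') x‖ ^ 2) *
            Real.sqrt (∫ x, frobeniusNormSq (fderiv ℝ (curl (u t')) x))} ∩
        Set.Icc τ (τ + c_w * ν / M ^ 2)) ⊆
      ({σ : ℝ | k σ ≤ m} ∩ Set.Icc τ (τ + c_w * ν / M ^ 2)) := by
    rintro t' ⟨hdep, ht'I⟩
    refine ⟨?_, ht'I⟩
    have ht'0 : 0 ≤ t' := hτ0.trans ht'I.1
    have ht'T : t' < T := lt_of_le_of_lt ht'I.2 hτT
    show k t' ≤ m
    by_contra hlt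
    push Not at hlt
    obtain ⟨M', hM', hstr⟩ := hkeff t' ⟨ht'0, ht'T⟩ m hm0 hlt
    have hM'0 : 0 ≤ M' := (norm_nonneg _).trans (hM' 0)
    have hle := hdep M' hM'
    have hP' : 0 ≤ M' * Real.sqrt (∫ x, ‖curl (u t') x‖ ^ 2) *
        Real.sqrt (∫ x, frobeniusNormSq (fderiv ℝ (curl (u t')) x)) := by positivity
    have hmono : (kStar - ε) * M' * Real.sqrt (∫ x, ‖curl (u t') x‖ ^ 2) *
        Real.sqrt (∫ x, frobeniusNormSq (fderiv ℝ (curl (u t')) x)) ≤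
        m * M' * Real.sqrt (∫ x, ‖curl (u t') x‖ ^ 2) *
        Real.sqrt (∫ x, frobeniusNormSq (fderiv ℝ (curl (u t')) x)) := by
      have h := mul_le_mul_of_nonneg_right hmε hP'
      calc (kStar - ε) * M' * Real.sqrt (∫ x, ‖curl (u t') x‖ ^ 2) *
            Real.sqrt (∫ x, frobeniusNormSq (fderiv ℝ (curl (u t')) x))
          = (kStar - ε) * (M' * Real.sqrt (∫ x, ‖curl (u t') x‖ ^ 2) *
            Real.sqrt (∫ x, frobeniusNormSq (fderiv ℝ (curl (u t')) x))) := by ring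
        _ ≤ m * (M' * Real.sqrt (∫ x, ‖curl (u t') x‖ ^ 2) *
            Real.sqrt (∫ x, frobeniusNormSq (fderiv ℝ (curl (u t')) x))) := h
        _ = m * M' * Real.sqrt (∫ x, ‖curl (u t') x‖ ^ 2) *
            Real.sqrt (∫ x, frobeniusNormSq (fderiv ℝ (curl (u t')) x)) := by ring
    exact absurd (lt_of_lt_of_le hstr (hle.trans hmono)) (lt_irrefl _)
  have hcmp : ENNReal.ofReal (ε * (c_w * ν / M ^ 2)) ≤ ENNReal.ofReal (ε / 2 * (c_w * ν / M ^ 2)) :=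
    (hfrac.trans (measure_mono hsub)).trans hclean
  have hI : 0 < c_w * ν / M ^ 2 := by positivity
  have hrhs : 0 ≤ ε / 2 * (c_w * ν / M ^ 2) := by positivity
  have hreal : ε * (c_w * ν / M ^ 2) ≤ ε / 2 * (c_w * ν / M ^ 2) := (ENNReal.ofReal_le_ofReal_iff hrhs).1 hcmp
  nlinarith [hreal, hI, hε]

/-- **LINE g13-α SKELETON** — the ONE theorem concluding the crux BY NAME from exactly the two registered stubs. -/
theorem NearExtremalTransiencePerFlow_of
    (hK : Registered.stub_smallBudgetDepletion) (hC : Registered.stub_crowdDepletion) :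
    NearExtremalTransiencePerFlow :=
  nearExtremalTransiencePerFlow_of_pinned (pinnedDepletedFraction_of hK hC)

/-- Sanity: the registered stubs compose to the crux by name. -/
example : NearExtremalTransiencePerFlow :=
  NearExtremalTransiencePerFlow_of stub_smallBudgetDepletion stub_crowdDepletion

/-- Sanity: the line of record's heart X♭ closes BOTH stubs of this line (the cut only asks for less). -/
example (hX : Summit.NavierStokesRegularity.NavierStokesRegularity.Theorems.NearExtremalTransiencePerFlow.DepletedFraction.DepletedFraction) :
    SmallBudgetDepletion ∧ CrowdDepletion :=
  ⟨smallBudgetDepletion_of_depletedFraction hX, crowdDepletion_of_depletedFraction hX⟩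

end Summit.NavierStokesRegularity.NavierStokesRegularity.Cruxes.NearExtremalTransiencePerFlow.BudgetCut

end
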